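import Mathlib
import HarnessLib
import Literature.AlgebraicGeometry.Resolution.BlowupStalkCharts
import Literature.AlgebraicGeometry.Resolution.BlowupChartQuasiRegular

/-!
# The stalk of a blow-up at a fixed point of a lifted automorphism: the chart package
(crux stmt-ResolutionOfSingularities-15640 `WildQuotients.WildQuotientResolution`, line `Sketch`;
chain w45c rung V3, design of record `L/res-L1-w45c-lead-1/V3-K3-DESIGN.md` §5 (d))

[OURS · L1 W4.5c; NOT a statement of the manuscript.] `TerminalBlowup.exists_span_stalkAug_eq`
(p468243) proves the Király–Lütkebohmert terminal state after ONE blow-up of an augmentation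
ideal with INVARIANT generators, by reducing the stalk statement to chart algebra. This file
isolates the reduction step, with NO hypothesis on the centre, so that other chart computations
(the `J₃` monomial ideal `K₃` of rung V3, whose generators are not invariant) can be plugged in:

* `TerminalBlowup.stalkAug_of_chartPackage` — let `π : V → X` be a blow-up along `J`
  (`IsBlowup`), `α ≫ π = π ≫ β`, `v ∈ V` fixed by `α`, and `c : Fin n → 𝒪_{X,s}` generators of
  the stalk `J_s`, `s = π v`. To prove ANY property `motive` of the augmentation ideal
  `⟨a y - y : y ∈ 𝒪_{V,v}⟩` of the stalk action `a = stalkSpecializes ≫ α^♯_v`, it suffices to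
  prove it given, for SOME chart index `j`, a presentation of `𝒪_{V,v}` as a localisation at a
  prime `𝔴` of the Rees chart ring `B_j = 𝒪_{X,s}[J_s/c_j]` (`χ : B_j → 𝒪_{V,v}` with
  `χ ∘ (𝒪_{X,s} → B_j) = π^♯_v`, `IsBlowup.exists_reesChart_stalk`) together with the
  intertwining `a ∘ π^♯_v = π^♯_v ∘ b` of the stalk actions (`b = stalkSpecializes ≫ β^♯_s`;
  cancel the monomorphism `Spec 𝒪_{X,s} → X`).
-/

-- single-problem summit: the doubled namespace component `ResolutionOfSingularities` is forced
set_option linter.dupNamespace false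

noncomputable section

open CategoryTheory AlgebraicGeometry TopologicalSpace IsLocalRing
open Literature.AlgebraicGeometry.Resolution

namespace Summit.ResolutionOfSingularities.ResolutionOfSingularities.Theorems.WildQuotientResolution.TerminalBlowup

universe u

/-- `β` fixes `s = π v` if `α` fixes `v` and `α ≫ π = π ≫ β`. [folklore] -/
theorem base_apply_eq_of_comm {V X : Scheme.{u}} {π : V ⟶ X} {α : V ⟶ V} {β : X ⟶ X}
    (hequiv : α ≫ π = π ≫ β) (v : V) (hv : α.base v = v) : β.base (π.base v) = π.base v := by
  have h := congrArg (fun f : V ⟶ X => f.base v) hequiv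
  simp only [Scheme.Hom.comp_base, TopCat.coe_comp, Function.comp_apply] at h
  rw [hv] at h
  exact h.symm

/-- **The stalk actions are intertwined by `π^♯_v`**: with `a = stalkSpecializes ≫ α^♯_v` and
`b = stalkSpecializes ≫ β^♯_{π v}`, `a (π^♯_v r) = π^♯_v (b r)` (cancel the monomorphism
`Spec 𝒪_{X,π v} → X`; `Scheme.SpecMap_stalkMap_fromSpecStalk`,
`Scheme.SpecMap_stalkSpecializes_fromSpecStalk`). [folklore] -/
theorem stalkAction_stalkMap_apply {V X : Scheme.{u}} {π : V ⟶ X} {α : V ⟶ V} {β : X ⟶ X}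
    (hequiv : α ≫ π = π ≫ β) (v : V) (hv : α.base v = v)
    (hs : β.base (π.base v) = π.base v) (r : X.presheaf.stalk (π.base v)) :
    (V.presheaf.stalkSpecializes (specializes_of_eq hv) ≫ α.stalkMap v).hom
        ((π.stalkMap v).hom r) =
      (π.stalkMap v).hom
        ((X.presheaf.stalkSpecializes (specializes_of_eq hs) ≫ β.stalkMap (π.base v)).hom r) := by
  set aH := V.presheaf.stalkSpecializes (specializes_of_eq hv) ≫ α.stalkMap v with haH
  set bH := X.presheaf.stalkSpecializes (specializes_of_eq hs) ≫ β.stalkMap (π.base v) with hbH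
  have hkeya : Spec.map aH ≫ V.fromSpecStalk v = V.fromSpecStalk v ≫ α := by
    rw [haH, Spec.map_comp, Category.assoc, Scheme.SpecMap_stalkSpecializes_fromSpecStalk,
      Scheme.SpecMap_stalkMap_fromSpecStalk]
  have hkeyb : Spec.map bH ≫ X.fromSpecStalk (π.base v) = X.fromSpecStalk (π.base v) ≫ β := by
    rw [hbH, Spec.map_comp, Category.assoc, Scheme.SpecMap_stalkSpecializes_fromSpecStalk,
      Scheme.SpecMap_stalkMap_fromSpecStalk]
  have hcompat : bH ≫ π.stalkMap v = π.stalkMap v ≫ aH := by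
    apply Spec.map_injective
    rw [← cancel_mono (X.fromSpecStalk (π.base v))]
    simp only [Spec.map_comp, Category.assoc, hkeyb, Scheme.SpecMap_stalkMap_fromSpecStalk,
      Scheme.SpecMap_stalkMap_fromSpecStalk_assoc]
    rw [reassoc_of% hkeya, hequiv]
  rw [← CommRingCat.comp_apply, ← CommRingCat.comp_apply, hcompat]

/-- **The chart package at a fixed point of a blow-up.** Let `π : V → X` be a blow-up along the
ideal sheaf `J` (`IsBlowup π J`), `α ≫ π = π ≫ β`, `v ∈ V` with `α v = v`, and
`c : Fin n → 𝒪_{X,s}` (`s = π v`) generators of the stalk `J_s`. Any property `motive` of the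
augmentation ideal `⟨a y - y : y ∈ 𝒪_{V,v}⟩` of the stalk action `a = stalkSpecializes ≫ α^♯_v`
follows once it is proved from a CHART PACKAGE: an index `j`, a ring map `χ` from the Rees chart
ring `B_j = 𝒪_{X,s}[J_s/c_j]` (`chartRing c j`) presenting `𝒪_{V,v}` as the localisation of
`B_j` at a prime `𝔴` over the maximal ideal of `𝒪_{X,s}`, with `χ ∘ chartBase = π^♯_v`, and the
intertwining `a (π^♯_v r) = π^♯_v (b r)` with the stalk action `b` of `β` at `s` (which `β`
fixes). (`IsBlowup.exists_reesChart_stalk` + `stalkAction_stalkMap_apply`.) [folklore]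
[cite: StacksProject, Tag 0804] -/
theorem stalkAug_of_chartPackage {V X : Scheme.{u}} {π : V ⟶ X} {J : X.IdealSheafData}
    (hπ : IsBlowup π J) {α : V ⟶ V} {β : X ⟶ X} (hequiv : α ≫ π = π ≫ β)
    (v : V) (hv : α.base v = v) {n : ℕ} (c : Fin n → X.presheaf.stalk (π.base v))
    (hc : Ideal.span (Set.range c) = stalkIdeal J (π.base v))
    (motive : Ideal (V.presheaf.stalk v) → Prop)
    (halg : ∀ (hs : β.base (π.base v) = π.base v) (j : Fin n)
      (𝔴 : PrimeSpectrum (chartRing c j)) (χ : chartRing c j →+* V.presheaf.stalk v),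
      (∀ r, χ (chartBase c j r) = (π.stalkMap v).hom r) →
      @IsLocalization.AtPrime _ _ (V.presheaf.stalk v) _ χ.toAlgebra 𝔴.asIdeal _ →
      𝔴.asIdeal.comap (chartBase c j) = maximalIdeal (X.presheaf.stalk (π.base v)) →
      (∀ r, (V.presheaf.stalkSpecializes (specializes_of_eq hv) ≫ α.stalkMap v).hom
          ((π.stalkMap v).hom r) =
        (π.stalkMap v).hom
          ((X.presheaf.stalkSpecializes (specializes_of_eq hs) ≫ β.stalkMap (π.base v)).hom r)) →
      motive (Ideal.span (Set.range fun y =>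
        (V.presheaf.stalkSpecializes (specializes_of_eq hv) ≫ α.stalkMap v).hom y - y))) :
    motive (Ideal.span (Set.range fun y =>
      (V.presheaf.stalkSpecializes (specializes_of_eq hv) ≫ α.stalkMap v).hom y - y)) := by
  have hs : β.base (π.base v) = π.base v := base_apply_eq_of_comm hequiv v hv
  obtain ⟨j, 𝔴, χ, hχ, hloc, hmax⟩ := hπ.exists_reesChart_stalk v c hc
  exact halg hs j 𝔴 χ hχ hloc hmax (stalkAction_stalkMap_apply hequiv v hv hs)

end Summit.ResolutionOfSingularities.ResolutionOfSingularities.Theorems.WildQuotientResolution.TerminalBlowup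

end
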